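import Summits.Ventures.PercRepro.GenQTypeTwoWindows
import Summits.Ventures.PercRepro.GenQTypeOneWindows

/-!
# PercRepro — THE DIAGONAL ROWS `q = 5 … 11` REDUCE TO THEIR HIGH LAYERS `t ∈ [3, q − 1]` (night-4, gen 3; sheet §52)

With the type-`2` windows (`GenQTypeTwoWindows.lean`) and the type-`1` windows (`GenQTypeOneWindows.lean`) in the
kernel, `OpenLayersCoreFree q` is exactly its high layers: `HighLayersCoreFree q` (the balances `0 ≤ Jq M G q t`,
`3 ≤ t ≤ q − 1`, on the coloop-free rank-`q` flats of rank-`(q + 2)` Core matroids) implies `OpenLayersCoreFree q`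
for every `5 ≤ q ≤ 11`, and every row `(q + 2, q)` of the range follows from the trace sums of the levels `4 … q − 1`
and the high layers of the levels `5 … q` (`rls_succ_succ_of_highLayers`).
-/

namespace PercRepro.GenQ

open Finset ThmH PerFlat SixFour ThmN NightThree

/-- **The high layers of level `q`**: the balances at types `3 … q − 1` on the coloop-free rank-`q` flats of
rank-`(q + 2)` Core matroids — `OpenLayersCoreFree q` without its type-`1` and type-`2` clauses. -/
def HighLayersCoreFree (q : ℕ) : Prop :=
  ∀ {β : Type} [DecidableEq β] (M : Matroid β) [M.Finite] (G : Finset β), Core M (q + 2) → G ∈ flatsQ M q →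
    TwoHyp M G q → mTr M G = 0 → ∀ t, 3 ≤ t → t + 1 ≤ q → 0 ≤ Jq M G q t

/-- **`ResidueCoreFree q` from the high layers** for `5 ≤ q ≤ 11`: the type-`1` window is the kernel theorem
`jq_one_nonneg_of_core` (vacuous at `q = 5`). -/
theorem residueCoreFree_of_high {q : ℕ} (hq' : q ≤ 11) (h : HighLayersCoreFree q) : ResidueCoreFree q := by
  intro β _ M _ G hc hG hF hfree
  exact ⟨fun h6 hk hwin => jq_one_nonneg_of_core hc h6 hq' hG hfree hk hwin, h M G hc hG hF hfree⟩

/-- **`OpenLayersCoreFree q` from the high layers** for `5 ≤ q ≤ 11`. -/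
theorem openLayersCoreFree_of_high {q : ℕ} (hq : 5 ≤ q) (hq' : q ≤ 11) (h : HighLayersCoreFree q) :
    OpenLayersCoreFree q :=
  openLayersCoreFree_of_residue hq hq' (residueCoreFree_of_high hq' h)

/-- **Every row `(q + 2, q)`, `5 ≤ q ≤ 11`, on every finite matroid from the trace sums of the levels `4 … q − 1`
and the high layers `t ∈ [3, q − 1]` of the levels `5 … q`.** -/
theorem rls_succ_succ_of_highLayers {α : Type} [DecidableEq α] (q : ℕ) (hq : 5 ≤ q) (hq' : q ≤ 11)
    (htr : ∀ q', 4 ≤ q' → q' + 1 ≤ q → TraceSumsCore q') (hhigh : ∀ q', 5 ≤ q' → q' ≤ q → HighLayersCoreFree q') :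
    ∀ (M : Matroid α) [M.Finite], RLS M (q + 2) q :=
  rls_succ_succ_of_residues q hq hq' htr
    (fun q' h5 hq'' => residueCoreFree_of_high (by omega) (hhigh q' h5 hq''))

/-! ## The per-row residues reduce to their high layers -/

/-- The high layers of `(8, 6)` on all rank-`6` flats of rank-`8` Core matroids (`t = 3, 4, 5`). -/
def EightSixHighLayersCore : Prop :=
  ∀ {β : Type} [DecidableEq β] (M : Matroid β) [M.Finite] (G : Finset β), Core M 8 → G ∈ flatsQ M 6 →
    ∀ t, 3 ≤ t → t ≤ 5 → 0 ≤ Jq M G 6 t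

/-- `EightSixResidueCore` from the high layers: the type-`1` window `8 ≤ g ≤ 9` is `jq_one_nonneg_of_lines_six`
(no coloop-freeness needed). -/
theorem eightSixResidueCore_of_high (h : EightSixHighLayersCore) : EightSixResidueCore := by
  intro β _ M _ G hc hG
  refine ⟨fun h8 h9 => ?_, h M G hc hG⟩
  exact jq_one_nonneg_of_lines_six (simple_of_core hc) (fun _ hL => card_le_three_of_line_of_core hc hL) hG h8
    (by omega)

/-- **C-025 at `(8, 6)` from `OpenLayersCore 5` and the high layers `t = 3, 4, 5` of level `6`.** -/
theorem rls_eight_six_of_high {α : Type} [DecidableEq α] (h5 : OpenLayersCore 5) (h6 : EightSixHighLayersCore)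
    (M : Matroid α) [M.Finite] : RLS M 8 6 :=
  rls_eight_six_of_residue h5 (eightSixResidueCore_of_high h6) M

/-- `NineSevenResidueCoreFree` from the high layers `t = 3 … 6` of level `7` on coloop-free flats. -/
theorem nineSevenResidueCoreFree_of_high
    (h : ∀ {β : Type} [DecidableEq β] (M : Matroid β) [M.Finite] (G : Finset β), Core M 9 → G ∈ flatsQ M 7 →
      mTr M G = 0 → ∀ t, 3 ≤ t → t ≤ 6 → 0 ≤ Jq M G 7 t) : NineSevenResidueCoreFree := by
  intro β _ M _ G hc hG hfree
  refine ⟨fun h9 h11 => ?_, h M G hc hG hfree⟩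
  exact jq_one_nonneg_of_lines_seven (simple_of_core hc) (fun _ hL => card_le_three_of_line_of_core hc hL) hG h9
    (by omega)

/-- `TenEightResidueCoreFree` from the high layers `t = 3 … 7` of level `8` on coloop-free flats. -/
theorem tenEightResidueCoreFree_of_high
    (h : ∀ {β : Type} [DecidableEq β] (M : Matroid β) [M.Finite] (G : Finset β), Core M 10 → G ∈ flatsQ M 8 →
      mTr M G = 0 → ∀ t, 3 ≤ t → t ≤ 7 → 0 ≤ Jq M G 8 t) : TenEightResidueCoreFree := by
  intro β _ M _ G hc hG hfree
  refine ⟨fun h10 h13 => ?_, h M G hc hG hfree⟩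
  exact jq_one_nonneg_of_lines_eight (simple_of_core hc) (fun _ hL => card_le_three_of_line_of_core hc hL) hG h10
    (by omega)

/-- `ElevenNineResidueCoreFree` from the high layers `t = 3 … 8` of level `9` on coloop-free flats. -/
theorem elevenNineResidueCoreFree_of_high
    (h : ∀ {β : Type} [DecidableEq β] (M : Matroid β) [M.Finite] (G : Finset β), Core M 11 → G ∈ flatsQ M 9 →
      mTr M G = 0 → ∀ t, 3 ≤ t → t ≤ 8 → 0 ≤ Jq M G 9 t) : ElevenNineResidueCoreFree := by
  intro β _ M _ G hc hG hfree
  refine ⟨fun h11 h15 => ?_, h M G hc hG hfree⟩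
  exact jq_one_nonneg_of_lines_nine (simple_of_core hc) (fun _ hL => card_le_three_of_line_of_core hc hL) hG h11
    (by omega)

/-- `TwelveTenResidueCoreFree` from the high layers `t = 3 … 9` of level `10` on coloop-free flats. -/
theorem twelveTenResidueCoreFree_of_high
    (h : ∀ {β : Type} [DecidableEq β] (M : Matroid β) [M.Finite] (G : Finset β), Core M 12 → G ∈ flatsQ M 10 →
      mTr M G = 0 → ∀ t, 3 ≤ t → t ≤ 9 → 0 ≤ Jq M G 10 t) : TwelveTenResidueCoreFree := by
  intro β _ M _ G hc hG hfree
  refine ⟨fun h12 h17 => ?_, h M G hc hG hfree⟩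
  exact jq_one_nonneg_of_lines_ten (simple_of_core hc) (fun _ hL => card_le_three_of_line_of_core hc hL) hG hfree
    h12 (by omega)

/-- `ThirteenElevenResidueCoreFree` from the high layers `t = 3 … 10` of level `11` on coloop-free flats. -/
theorem thirteenElevenResidueCoreFree_of_high
    (h : ∀ {β : Type} [DecidableEq β] (M : Matroid β) [M.Finite] (G : Finset β), Core M 13 → G ∈ flatsQ M 11 →
      mTr M G = 0 → ∀ t, 3 ≤ t → t ≤ 10 → 0 ≤ Jq M G 11 t) : ThirteenElevenResidueCoreFree := by
  intro β _ M _ G hc hG hfree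
  refine ⟨fun h13 h19 => ?_, h M G hc hG hfree⟩
  exact jq_one_nonneg_of_lines_eleven (simple_of_core hc) (fun _ hL => card_le_three_of_line_of_core hc hL) hG hfree
    h13 (by omega)

end PercRepro.GenQ
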